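import Summits.ResolutionOfSingularities.ResolutionOfSingularities.Theses.TeissierJung
import Literature.AlgebraicGeometry.Resolution.TeissierPresentation
import Literature.AlgebraicGeometry.Resolution.AlterationsFormalCoordinates
import Literature.AlgebraicGeometry.Motives.VarietiesProperProofs

/-!
# `TeissierReduction` (crux stmt-ResolutionOfSingularities-17085, route `TeissierJung`):
# the crux AS TYPED is implied by resolution of singularities — a counterexample to it would be an
# integral projective hypersurface WITHOUT any resolution (negative-side support, refuter
# crux-disprover seat; this file does NOT refute the crux)

`TeissierReduction` asks, for every prime `p`, every algebraically closed `k` of characteristic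
`p` and every integral hypersurface `H ⊆ ℙᵐ_k`, for a proper birational `ρ : X' → H` with
`TF X'`: `X'` integral and finite over a regular integral separated finite-type `k`-scheme `S`,
every analytic branch `𝒪̂_{X',x} ⧸ P` at every closed point carrying a Mourtada–Schober (Teissier)
presentation over `𝒪̂_{S,π x} ≅ k⟦x₁, …, x_d⟧`.

The INTENDED content (Mourtada–Schober 2025, p. 4: Jung's reduction in characteristic `p`,
"blow up only the regular base of a finite projection") is not enforced by the type: the
predicate `TF` admits the DEGENERATE WITNESS `S := X'`, `π := 𝟙`, `g := 0` at every branch as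
soon as `X'` is regular (`teissierPresented_of_isRegular`: Cohen's structure theorem
`𝒪̂_{X',x} ≅ k⟦x₁, …, x_d⟧` at a regular closed point, `exists_ringEquiv_adicCompletion_stalk_mvPowerSeries`,
and the empty Teissier datum, `TeissierPresentation.mvPowerSeries`). Consequently

* `exists_hypersurface_not_hasResolution_of_not_teissierReduction` — a disproof of the crux
  produces a prime `p`, an algebraically closed field `k` of characteristic `p` and an integral
  hypersurface `H ⊆ ℙᵐ_k` (locally principal ideal) admitting NO resolution of singularities;
* `not_resolutionOfSingularities_of_not_teissierReduction` — in particular it disproves the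
  summit `ResolutionOfSingularities` itself.

Moral for the crux chain: the crux cannot be killed by any surface / threefold computation (where
resolution is a theorem, Cossart–Piltant 2019) nor, in any dimension, without settling the summit
negatively; the route's printed kill criterion ("a surface germ no base modification makes
Teissier") concerns the intended Jung square `X' = H ×_{ℙ^d} S`, `S → ℙ^d` a modification of the
base of a finite projection, which the typed item does not mention. Any genuinely negative result
about Jung reduction to the Teissier class must therefore be stated against a STRENGTHENED
signature (recorded in the crux work file `Cruxes/TeissierReduction/Disproof.lean`).
-/

noncomputable section

set_option linter.dupNamespace false

namespace Summit.ResolutionOfSingularities.ResolutionOfSingularities.Theorems.TeissierReduction.Negative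

open CategoryTheory AlgebraicGeometry IsLocalRing
open Literature.AlgebraicGeometry.Resolution
open Summit.ResolutionOfSingularities.ResolutionOfSingularities.Theses.TeissierJung

universe u

/-- An ideal of a Noetherian ring is generated by a family indexed by `Fin (spanFinrank I)`.
[folklore] -/
private theorem exists_span_range_eq {A : Type*} [CommRing A] [IsNoetherianRing A]
    (I : Ideal A) : ∃ x : Fin I.spanFinrank → A, Ideal.span (Set.range x) = I := by
  obtain ⟨s, hcard, hspan⟩ :=
    Submodule.FG.exists_span_finset_card_eq_spanFinrank (IsNoetherian.noetherian I)
  refine ⟨fun i => (s.equivFin.symm (Fin.cast hcard.symm i) : A), ?_⟩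
  have hr : Set.range (fun i => (s.equivFin.symm (Fin.cast hcard.symm i) : A)) = (s : Set A) := by
    ext a
    simp only [Set.mem_range, Finset.mem_coe]
    constructor
    · rintro ⟨i, rfl⟩; exact Finset.coe_mem _
    · intro ha; exact ⟨Fin.cast hcard (s.equivFin ⟨a, ha⟩), by simp⟩
  rw [hr]
  exact hspan

/-- **The degenerate witness.** A regular, integral, separated `k`-scheme of finite type over an
algebraically closed field `k` is Teissier-presented (`TeissierPresented k X`, i.e. the predicate
`TF X` of the route) OVER ITSELF: `S := X`, `π := 𝟙 X`, and at every closed point `x` the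
completed local ring is a domain `𝒪̂_{X,x} ≅ k⟦x₁, …, x_d⟧` (Cohen), whose only branch `P = ⊥`
carries the empty Teissier datum `g = 0`. No finite projection, no base modification and no
polyhedron enters. [folklore] -/
theorem teissierPresented_of_isRegular {k : Type u} [Field k] [IsAlgClosed k] (X : Scheme.{u})
    (f : X ⟶ Spec (.of k)) [IsSeparated f] [LocallyOfFiniteType f] [QuasiCompact f]
    [IsIntegral X] (hreg : Scheme.IsRegular X) : TeissierPresented k X := by
  refine ⟨X, f, 𝟙 X, ‹_›, ‹_›, ‹_›, ‹_›, hreg, ‹_›, inferInstance, fun x hx P hP => ?_⟩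
  haveI : IsRegularLocalRing (X.presheaf.stalk x) := hreg x
  obtain ⟨z, hz⟩ := exists_span_range_eq (maximalIdeal (X.presheaf.stalk x))
  have hd : ringKrullDim (X.presheaf.stalk x) =
      ((maximalIdeal (X.presheaf.stalk x)).spanFinrank : ℕ) :=
    (IsRegularLocalRing.spanFinrank_maximalIdeal).symm
  obtain ⟨e, -⟩ := exists_ringEquiv_adicCompletion_stalk_mvPowerSeries f hx z hz hd
  haveI : IsDomain (MvPowerSeries (Fin (maximalIdeal (X.presheaf.stalk x)).spanFinrank) k) :=
    NoZeroDivisors.to_isDomain _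
  haveI : IsDomain (AdicCompletion (maximalIdeal (X.presheaf.stalk x)) (X.presheaf.stalk x)) :=
    e.toMulEquiv.isDomain
  have hP0 : P = ⊥ := by
    rw [IsDomain.minimalPrimes_eq_singleton_bot] at hP
    exact hP
  subst hP0
  refine ⟨_, e, (e.symm.trans (RingEquiv.quotientBot _).symm).toRingHom.comp (RingHom.id _),
    (TeissierPresentation.mvPowerSeries k
      (maximalIdeal (X.presheaf.stalk x)).spanFinrank).of_ringEquiv
      (e.symm.trans (RingEquiv.quotientBot _).symm), fun a => ?_⟩
  simp only [Scheme.Hom.stalkMap_id]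
  exact congrArg (Ideal.Quotient.mk ⊥) (e.symm_apply_apply _)

/-- The source of a resolution of an integral scheme is integral (reduced since regular,
irreducible since birational to an irreducible scheme). [folklore] -/
private theorem isIntegral_of_isResolution {X' X : Scheme.{u}} {π : X' ⟶ X} [IsIntegral X]
    (h : IsResolution π) : IsIntegral X' := by
  haveI : ∀ z : X', _root_.IsReduced (X'.presheaf.stalk z) := fun z => by
    haveI := h.isRegular z
    haveI := isDomain_of_isRegularLocalRing (X'.presheaf.stalk z)
    infer_instance
  haveI : IsReduced X' := isReduced_of_isReduced_stalk X'
  haveI : IrreducibleSpace X' := ComponentGluing.IsBirational.irreducibleSpace h.isBirational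
  exact isIntegral_of_irreducibleSpace_of_isReduced X'

/-- **A counterexample to the crux is a non-resolvable hypersurface.** If `TeissierReduction`
fails then for some prime `p`, some algebraically closed field `k` of characteristic `p` and some
integral closed `H ⊆ ℙᵐ_k` with locally principal ideal, `H` has NO resolution of singularities:
otherwise a resolution `X' → H` (proper, birational, `X'` regular — hence integral) is already a
witness of the crux, `X'` being Teissier-presented over itself (`teissierPresented_of_isRegular`
and the bridge `teissierPresented_iff` to the let-bound `TF`). So the crux is exactly as safe as
resolution of projective hypersurfaces over algebraically closed fields; no computation in
dimension `≤ 3` can kill it. [folklore] -/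
theorem exists_hypersurface_not_hasResolution_of_not_teissierReduction (h : ¬ TeissierReduction) :
    ∃ p : ℕ, p.Prime ∧ ∃ (k : Type) (_ : Field k) (_ : CharP k p) (_ : IsAlgClosed k) (m : ℕ)
      (H : Scheme.{0}) (ι' : H ⟶ (Literature.AlgebraicGeometry.Motives.projectiveSpace m k).left),
      IsClosedImmersion ι' ∧ IsIntegral H ∧
      (∀ y : (Literature.AlgebraicGeometry.Motives.projectiveSpace m k).left,
        ∃ U : (Literature.AlgebraicGeometry.Motives.projectiveSpace m k).left.affineOpens,
          y ∈ (U : (Literature.AlgebraicGeometry.Motives.projectiveSpace m k).left.Opens) ∧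
          (ι'.ker.ideal U).IsPrincipal) ∧
      ¬ Scheme.HasResolution H := by
  by_contra hall
  push Not at hall
  apply h
  intro p hp k _ _ _ TF m H ι' hι hH hprinc
  have hres : Scheme.HasResolution H :=
    hall p hp k inferInstance inferInstance inferInstance m H ι' hι hH hprinc
  haveI := Literature.AlgebraicGeometry.Motives.isProper_projectiveSpace m k
  haveI : IsClosedImmersion ι' := hι
  haveI : IsIntegral H := hH
  obtain ⟨X', ρ, hρ⟩ := hres
  haveI := hρ.isProper
  haveI : IsIntegral X' := isIntegral_of_isResolution hρ
  refine ⟨X', ρ, hρ.isProper, hρ.isBirational, ?_⟩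
  exact (teissierPresented_iff k X').1 (teissierPresented_of_isRegular X'
    (ρ ≫ ι' ≫ (Literature.AlgebraicGeometry.Motives.projectiveSpace m k).hom) hρ.isRegular)

/-- **Any disproof of the crux disproves the summit**: `¬ TeissierReduction → ¬
ResolutionOfSingularities` (the non-resolvable hypersurface of
`exists_hypersurface_not_hasResolution_of_not_teissierReduction` is a reduced separated
finite-type scheme over a field of characteristic `p`). [folklore] -/
theorem not_resolutionOfSingularities_of_not_teissierReduction (h : ¬ TeissierReduction) :
    ¬ _root_.ResolutionOfSingularities := by
  intro hR
  obtain ⟨p, hp, k, _, _, _, m, H, ι', hι, hH, -, hno⟩ :=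
    exists_hypersurface_not_hasResolution_of_not_teissierReduction h
  haveI := Literature.AlgebraicGeometry.Motives.isProper_projectiveSpace m k
  haveI : IsClosedImmersion ι' := hι
  haveI : IsIntegral H := hH
  exact hno (hR p hp k H (ι' ≫ (Literature.AlgebraicGeometry.Motives.projectiveSpace m k).hom)
    inferInstance inferInstance inferInstance inferInstance)

end Summit.ResolutionOfSingularities.ResolutionOfSingularities.Theorems.TeissierReduction.Negative

end
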